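import Literature.Barriers.NavierStokesRegularity.NavierStokesInequalitySingularSolutions
import Literature.Barriers.NavierStokesRegularity.NavierStokesInequalityGluingLEI
import HarnessLib

/-!
# Gluing weak solutions of the Navier–Stokes inequality along a sequence of switching times, III

Assembly of `NavierStokesInequalityGluing.lean` (weak divergence, weak spatial gradient) and
`NavierStokesInequalityGluingLEI.lean` (local energy inequality) into the tree's rendering
`IsWeakNSISolution` (Ożański 2020, Def. 1.1) of a weak solution of the Navier–Stokes inequality
on `ℝ³ × (0,∞)`: **a piecewise-classical field glued along switching times `t_j ↑ T₀` with
dropping magnitudes, vanishing from `T₀` on, with finite energy and globally integrable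
energy-class quantities, is a weak NSI solution** (`isWeakNSISolution_of_piecewise`). This is
the abstract content of Ożański 2017, §2 ("Thus letting `𝔲(t) = u^{(j)}(t)` … we obtain a vector
field that satisfies the claims of Theorem 1") and of Scheffer 1985, proof of Lemma 2.3
((2.32)–(2.34) ⇒ (2.29), (1.1)–(1.6)); the verification of the hypotheses for Scheffer's
rescaled pieces is a separate matter.

## References

* W. S. Ożański, arXiv:1709.00602 (2017), §2 pp. 6–7. [`Ozanski2017NSISingular`]
* V. Scheffer, Comm. Math. Phys. 101 (1985), proof of Lemma 2.3. [`Scheffer1985`]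
* W. S. Ożański, Comm. Math. Phys. 374 (2020), Def. 1.1. [`Ozanski2019NSI`]
-/

noncomputable section

open MeasureTheory Set Function Filter Topology TopologicalSpace Metric
open scoped ENNReal InnerProductSpace RealInnerProductSpace ContDiff Laplacian

namespace Literature.Barriers.NavierStokesRegularity

open Literature.Analysis.FluidPDE

variable {t : ℕ → ℝ} {T₀ ν : ℝ} {𝔲 : ℝ → (EuclideanSpace ℝ (Fin 3)) → (EuclideanSpace ℝ (Fin 3))} {p : ℝ → (EuclideanSpace ℝ (Fin 3)) → ℝ}
  {Gr : ℝ → (EuclideanSpace ℝ (Fin 3)) → (EuclideanSpace ℝ (Fin 3)) →L[ℝ] (EuclideanSpace ℝ (Fin 3))} {v : ℕ → ℝ → (EuclideanSpace ℝ (Fin 3)) → (EuclideanSpace ℝ (Fin 3))} {q : ℕ → ℝ → (EuclideanSpace ℝ (Fin 3)) → ℝ}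

/-- **The pressure conjunct of the glued field**: if on each piece the pressure slice `q_j(s)` is
in `L^{3/2}` and solves `-Δq = ∂ᵢ∂ⱼ(vᵢvⱼ)` weakly, and `𝔲 = 0`, `p = 0` from `T₀` on, then `p` is
the pressure function of `𝔲` on `(0,∞)` in the sense of `IsPressureOf` (Ożański 2020, (1.1)).
[cite: Ozanski2019NSI, Def. 1.1 and (1.1)] -/
theorem isPressureOf_of_piecewise (h0 : t 0 = 0) (hT : Tendsto t atTop (𝓝 T₀))
    (hagree : ∀ j, ∀ s ∈ Ico (t j) (t (j + 1)), 𝔲 s = v j s ∧ p s = q j s)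
    (hzero : ∀ s, T₀ ≤ s → 𝔲 s = 0 ∧ p s = 0)
    (hpres : ∀ j, ∀ s ∈ Ico (t j) (t (j + 1)), MemLp (q j s) (3 / 2 : ℝ≥0∞) volume ∧
      ∀ ψ : (EuclideanSpace ℝ (Fin 3)) → ℝ, Literature.Analysis.FunctionSpaces.IsTestFunctionOn (⊤ : Opens (EuclideanSpace ℝ (Fin 3))) ψ →
        -∫ x, q j s x * Δ ψ x = ∫ x, fderiv ℝ (fderiv ℝ ψ) x (v j s x) (v j s x)) :
    IsPressureOf 𝔲 p := by
  rw [IsPressureOf, ae_restrict_iff' measurableSet_Ioi]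
  refine ae_of_all _ fun s (hs : 0 < s) => ?_
  rcases time_trichotomy h0 hT s with hs' | ⟨j, hj⟩ | hs'
  · exact absurd hs (not_lt.2 hs')
  · obtain ⟨hu, hp⟩ := hagree j s hj
    rw [hu, hp]
    exact hpres j s hj
  · obtain ⟨hu, hp⟩ := hzero s hs'
    refine ⟨by rw [hp]; exact MemLp.zero, fun ψ _ => ?_⟩
    simp [hu, hp]

/-- **Gluing principle for the Navier–Stokes inequality (Ożański 2017, §1–§2; Scheffer 1985,
Lemma 2.3).** Let `0 = t₀ < t₁ < ⋯ → T₀`. Let `𝔲 : ℝ × ℝ³ → ℝ³`, `p`, `Gr` agree on each piece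
`[t_j, t_{j+1})` with fields `v_j` (with `C¹` divergence-free slices on `[t_j, t_{j+1}]`), `q_j`
and the slice derivatives `D v_j`, and vanish from `T₀` on. Assume: (i) on each piece the local
energy inequality WITH BOUNDARY TERMS on `[t_j, t_{j+1}]` for every nonnegative test function on
`(0,∞) × ℝ³` (Ożański's (1.6)); (ii) the drops `|v_{j+1}(t_{j+1}, x)| ≤ |v_j(t_{j+1}, x)|`
((2.6)); (iii) on each piece the pressure slices are in `L^{3/2}` and solve the pressure Poisson
equation weakly; (iv) `sup_{s>0} ∫|𝔲(s)|² < ∞`; (v) `𝔲, Gr ∈ L¹((0,∞) × ℝ³)`, `p` measurable,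
and `|𝔲|², |𝔲|³, |p||𝔲|, |Gr|² ∈ L¹((0,∞) × ℝ³)`. Then `(𝔲, p)` is a weak solution of the
Navier–Stokes inequality with viscosity `ν` on `ℝ³ × (0,∞)` (`IsWeakNSISolution ν 𝔲 p`), with
weak spatial gradient `Gr`. [cite: Ozanski2017NSISingular, §1 (1.6) and §2 pp. 6–7]
[cite: Scheffer1985, Lemma 2.3] -/
theorem isWeakNSISolution_of_piecewise (ht : StrictMono t) (h0 : t 0 = 0)
    (hT : Tendsto t atTop (𝓝 T₀))
    (hagree : ∀ j, ∀ s ∈ Ico (t j) (t (j + 1)),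
      𝔲 s = v j s ∧ p s = q j s ∧ Gr s = fun x => fderiv ℝ (v j s) x)
    (hzero : ∀ s, T₀ ≤ s → 𝔲 s = 0 ∧ p s = 0 ∧ Gr s = 0)
    (hC1 : ∀ j, ∀ s ∈ Icc (t j) (t (j + 1)), ContDiff ℝ 1 (v j s))
    (hdiv : ∀ j, ∀ s ∈ Ico (t j) (t (j + 1)), VectorCalculus.IsDivFree (v j s))
    (hdrop : ∀ j x, ‖v (j + 1) (t (j + 1)) x‖ ≤ ‖v j (t (j + 1)) x‖)
    (hLEI : ∀ j (φ : ℝ → (EuclideanSpace ℝ (Fin 3)) → ℝ), IsSpaceTimeTestOn positiveTimes φ → (∀ s x, 0 ≤ φ s x) →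
      (∫ x, ‖v j (t (j + 1)) x‖ ^ 2 * φ (t (j + 1)) x) - (∫ x, ‖v j (t j) x‖ ^ 2 * φ (t j) x) +
          2 * ν * ∫ s in Ioo (t j) (t (j + 1)), ∫ x, frobeniusNormSq (fderiv ℝ (v j s) x) * φ s x ≤
        ∫ s in Ioo (t j) (t (j + 1)), ∫ x, (‖v j s x‖ ^ 2 * (timeDeriv φ s x + ν * Δ (φ s) x) +
          (‖v j s x‖ ^ 2 + 2 * q j s x) * ⟪v j s x, gradient (φ s) x⟫))
    (hpres : ∀ j, ∀ s ∈ Ico (t j) (t (j + 1)), MemLp (q j s) (3 / 2 : ℝ≥0∞) volume ∧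
      ∀ ψ : (EuclideanSpace ℝ (Fin 3)) → ℝ, Literature.Analysis.FunctionSpaces.IsTestFunctionOn (⊤ : Opens (EuclideanSpace ℝ (Fin 3))) ψ →
        -∫ x, q j s x * Δ ψ x = ∫ x, fderiv ℝ (fderiv ℝ ψ) x (v j s x) (v j s x))
    (henergy : ∃ C : ℝ≥0∞, C < ⊤ ∧ ∀ s : ℝ, 0 < s → ∫⁻ x, ‖𝔲 s x‖ₑ ^ 2 ≤ C)
    (hint𝔲 : IntegrableOn (uncurry 𝔲) ((positiveTimes : Opens (ℝ × (EuclideanSpace ℝ (Fin 3)))) : Set (ℝ × (EuclideanSpace ℝ (Fin 3)))) volume)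
    (hintG : IntegrableOn (uncurry Gr) ((positiveTimes : Opens (ℝ × (EuclideanSpace ℝ (Fin 3)))) : Set (ℝ × (EuclideanSpace ℝ (Fin 3)))) volume)
    (hmeasp : AEStronglyMeasurable (uncurry p)
      (volume.restrict ((positiveTimes : Opens (ℝ × (EuclideanSpace ℝ (Fin 3)))) : Set (ℝ × (EuclideanSpace ℝ (Fin 3))))))
    (hI2 : Integrable (fun z : ℝ × (EuclideanSpace ℝ (Fin 3)) => ‖𝔲 z.1 z.2‖ ^ 2)
      (volume.restrict ((positiveTimes : Opens (ℝ × (EuclideanSpace ℝ (Fin 3)))) : Set (ℝ × (EuclideanSpace ℝ (Fin 3))))))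
    (hI3 : Integrable (fun z : ℝ × (EuclideanSpace ℝ (Fin 3)) => ‖𝔲 z.1 z.2‖ ^ 3)
      (volume.restrict ((positiveTimes : Opens (ℝ × (EuclideanSpace ℝ (Fin 3)))) : Set (ℝ × (EuclideanSpace ℝ (Fin 3))))))
    (hIp : Integrable (fun z : ℝ × (EuclideanSpace ℝ (Fin 3)) => |p z.1 z.2| * ‖𝔲 z.1 z.2‖)
      (volume.restrict ((positiveTimes : Opens (ℝ × (EuclideanSpace ℝ (Fin 3)))) : Set (ℝ × (EuclideanSpace ℝ (Fin 3))))))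
    (hIG : Integrable (fun z : ℝ × (EuclideanSpace ℝ (Fin 3)) => frobeniusNormSq (Gr z.1 z.2))
      (volume.restrict ((positiveTimes : Opens (ℝ × (EuclideanSpace ℝ (Fin 3)))) : Set (ℝ × (EuclideanSpace ℝ (Fin 3)))))) :
    IsWeakNSISolution ν 𝔲 p where
  divFree θ hθ :=
    integral_inner_gradient_eq_zero_of_piecewise h0 hT (fun j s hs => (hagree j s hs).1)
      (fun s hs => (hzero s hs).1) (fun j s hs => hC1 j s (Ico_subset_Icc_self hs)) hdiv hint𝔲 hθ
  energy := henergy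
  pressure :=
    isPressureOf_of_piecewise h0 hT (fun j s hs => ⟨(hagree j s hs).1, (hagree j s hs).2.1⟩)
      (fun s hs => ⟨(hzero s hs).1, (hzero s hs).2.1⟩) hpres
  localEnergy := by
    refine ⟨Gr, ?_, ?_, ?_⟩
    · exact hasWeakSpatialGradientOn_of_piecewise ht h0 hT
        (fun j s hs => ⟨(hagree j s hs).1, (hagree j s hs).2.2⟩)
        (fun s hs => ⟨(hzero s hs).1, (hzero s hs).2.2⟩)
        (fun j s hs => hC1 j s (Ico_subset_Icc_self hs)) hint𝔲 hintG
    · calc ∫⁻ z in ((positiveTimes : Opens (ℝ × (EuclideanSpace ℝ (Fin 3)))) : Set (ℝ × (EuclideanSpace ℝ (Fin 3)))),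
            ENNReal.ofReal (frobeniusNormSq (Gr z.1 z.2))
          ≤ ∫⁻ z in ((positiveTimes : Opens (ℝ × (EuclideanSpace ℝ (Fin 3)))) : Set (ℝ × (EuclideanSpace ℝ (Fin 3)))),
            ‖frobeniusNormSq (Gr z.1 z.2)‖ₑ := lintegral_ofReal_le_lintegral_enorm _
        _ < ⊤ := hIG.2
    · intro φ hφ hφ0
      exact localEnergyIneq_of_piecewise ht h0 hT hagree (fun s hs => ⟨(hzero s hs).1, (hzero s hs).2.2⟩)
        (fun j s hs => (hC1 j s hs).continuous) hdrop hLEI hint𝔲.aestronglyMeasurable hmeasp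
        hintG.aestronglyMeasurable hI2 hI3 hIp hIG hφ hφ0

end Literature.Barriers.NavierStokesRegularity

end
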